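import Summits.Ventures.CertifiedManyBodySolver.Downfold.EmeryBoxesLa214Levels
import Summits.Ventures.CertifiedManyBodySolver.Downfold.EmeryReadingSeam
import HarnessLib

/-!
# U-SLICES OF RECORD for La₂CuO₄'s DFT-level 3BE sub-box under reading fl (ruling R-B16(b)): one typed six-box per NAMED literature
# `(U_dd, U_pp)` pair — `emeryBoxLa214CLDA` (10.5, 4.0), `emeryBoxLa214CRPA` (7.00, 4.64), `emeryBoxLa214Kung` (8.5, 4.1)

Venture CertifiedManyBodySolver, cell `pub/hubbard-downfold` (stage S1 = ROUTER), seat hubbard-downfold-mod-4 (S1/S2 Emery seam); namespace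
`Summit.Ventures.CertifiedManyBodySolver.Downfold`. RULING R-B16 (lead g6, 2026-08-27T12:40:54Z): «(a) TB-occ ADMISSIBLE as reference occupations for
KS/GW members' bare-e images; (b) U-SLICED sub-boxes per NAMED existing U-row member are the rows of record for members without an own U pair; the
companion-U hull row stays as labelled SOUND ENCLOSURE, never an S2 input — mod-4 types the slices». A SLICE here = the companion box with `Delta_pd`
narrowed to the KS/DFT-level sub-range, `(U_dd, U_pp)` PINNED at one named literature pair, and then `Delta_pd` replaced by its bare-electron
(V_pd at mean field) image `Δ^e = Δ − (U_dd n̄_d − U_pp n̄_p)/2` over the TB-occ reference range (one-body occupations of the printed quartets ∪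
box-corner occupations at n = 1, padded (0.03, 0.015); cell file router/INFLATION-RULES-3to1-B.md §B.23, kit j277953/j278172). Each slice is a
PRODUCT box the seam doors accept; its Δ^e width is the intrinsic part only (Δ sub-range + occupation covariation ≈ 1.5–2.5 eV), the U-row
inheritance being removed by the pinning (§B.23(h)). Everything PROVED (0 sorry); SCREENING-GRADE inputs typed verbatim; nothing about the
material is certified; grade = that of the source entries. VERSION RULE: a re-print of the companion or a new named U pair ⇒ a NEW slice def.

THIS FILE — source: `emeryBoxLa214DFT` (`EmeryBoxesLa214Levels` p521912; Δ_DFT [1.7, 2.92] = run-7 c/p, tool-1 w3b, Weber2012, (K) 1, Hirayama GWA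
one-body; U_dd [7, 10.5], U_pp [3.4, 4.64]); the companion's NAMED U pairs with BOTH entries located: «la214CLDA» (21/2, 4): Δ^e [-269/100, -9/50], budget 8.46; «la214CRPA» (7, 116/25): Δ^e [1/2, 269/100], budget 7.82; «la214Kung» (17/2, 41/10): Δ^e [-11/10, 121/100], budget 8.06. (Chiciak 2020's 8.4/2.0 has U_pp outside the
companion row; Kent 2008's cLDA 9.5 and Arrigoni's derived U_pp have no pair — no slice.) TB-occ range n̄_d [1.296, 1.502], n̄_p [1.749, 1.852]. Per slice:
`…Emery_Udd/_Upp/_Delta`, source sub-box `emeryBox…Src` (+ `_refines` the DFT sub-box), the slice `emeryBox…` (= `Function.update` of the source's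
Δ), `flImage_mem_…` (sound replacement), `holdsOn_…Src_fl`, `_entries`, `…_emeryLoHi`, `_energyFloor` (64 vertices, 16 distinct), `_energyFloor_lowerFace`
(4 corners), `…_widthBudget`. The three Δ^e slices are nearly DISJOINT ([−2.69, −0.18] / [0.50, 2.69] / [−1.10, 1.21]): the U school, not the DFT,
decides where La₂CuO₄'s bare d level sits — the located content of R-B16(b). The sound ENCLOSURE over the whole U hull is `emeryBoxLa214DFTFl`
(`EmeryBoxesLa214Fl`, [−3.22, 2.69]; never an S2 input per the ruling).
-/

namespace Summit.Ventures.CertifiedManyBodySolver.Downfold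

open NonemptyInterval Literature.MathematicalPhysics.QuantumLattice

noncomputable section

/-! ### Slice «cLDA pair HSC89 (U_dd 10.5, U_pp 4.0; V_pd 1.2) via Dagotto1994 p.9»: `(U_dd, U_pp) = (21/2, 4)` -/

/-- `Udd` pinned at the named member's value `21/2` («cLDA pair HSC89 (U_dd 10.5, U_pp 4.0; V_pd 1.2) via Dagotto1994 p.9»). [folklore] -/
def la214CLDAEmery_Udd : Entry := Entry.ofEnds (21/2) (21/2) le_rfl .screening
/-- `Upp` pinned at `4` («cLDA pair HSC89 (U_dd 10.5, U_pp 4.0; V_pd 1.2) via Dagotto1994 p.9»). [folklore] -/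
def la214CLDAEmery_Upp : Entry := Entry.ofEnds (4) (4) le_rfl .screening
/-- **The bare-electron (V@MF) `Delta_pd` entry of the slice «cLDA pair HSC89 (U_dd 10.5, U_pp 4.0; V_pd 1.2) via Dagotto1994 p.9»**: `[-269/100, -9/50]` = outward 2-dp rounding of
`[17/10 − 21/2·751/500/2 + 4·1749/1000/2, 73/25 − 21/2·162/125/2 + 4·463/250/2] = [-2.6875, -0.1800]` (Δ source range
[17/10, 73/25], TB-occ reference range n̄_d ∈ [162/125, 751/500], n̄_p ∈ [1749/1000, 463/250]). By-member TB-occ images at this pair: see the table in the module docstring. [folklore] -/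
def la214CLDAEmery_Delta : Entry := Entry.ofEnds (-269/100) (-9/50) (by norm_num) .screening

/-- The SOURCE sub-box of the slice: the companion with `Delta_pd` narrowed to `la214DFTEmery_Delta` and `(U_dd, U_pp)` pinned at the named member
(a sub-box of `emeryBoxLa214DFT`: `emeryBoxLa214CLDASrc_refines`). [folklore] -/
def emeryBoxLa214CLDASrc : EmeryBox := fun c =>
  match c with
  | .DeltaPd => some la214DFTEmery_Delta
  | .tpd => some la214Emery_tpd
  | .tpp => some la214Emery_tpp
  | .tppP => some la214Emery_tppP
  | .Udd => some la214CLDAEmery_Udd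
  | .Upp => some la214CLDAEmery_Upp
  | .Vpd => some la214Emery_Vpd
  | .nHoles => some la214Emery_nH

/-- **The U-SLICE «cLDA pair HSC89 (U_dd 10.5, U_pp 4.0; V_pd 1.2) via Dagotto1994 p.9»** (row of record per R-B16(b)): the source sub-box with `Delta_pd` replaced by its bare-e image `la214CLDAEmery_Delta`. [folklore] -/
def emeryBoxLa214CLDA : EmeryBox := Function.update emeryBoxLa214CLDASrc .DeltaPd (some la214CLDAEmery_Delta)

/-- The source sub-box refines the companion `emeryBoxLa214DFT` (pinned U values and the Δ sub-range lie inside the companion rows). [folklore] -/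
theorem emeryBoxLa214CLDASrc_refines : emeryBoxLa214CLDASrc.Refines emeryBoxLa214DFT := by
  intro p hp i e hi
  cases i <;> simp only [emeryBoxLa214DFT, Option.some.injEq] at hi <;> subst hi
  · have h := (Entry.mem_ofEnds_iff _ _ _ _ _).1 (hp .DeltaPd la214DFTEmery_Delta rfl)
    exact (Entry.mem_ofEnds_iff _ _ _ _ _).2 ⟨le_trans (by exact_mod_cast (by norm_num)) h.1, le_trans h.2 (by exact_mod_cast (by norm_num))⟩
  · exact hp .tpd _ rfl
  · exact hp .tpp _ rfl
  · exact hp .tppP _ rfl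
  · have h := (Entry.mem_ofEnds_iff _ _ _ _ _).1 (hp .Udd la214CLDAEmery_Udd rfl)
    exact (Entry.mem_ofEnds_iff _ _ _ _ _).2 ⟨le_trans (by exact_mod_cast (by norm_num)) h.1, le_trans h.2 (by exact_mod_cast (by norm_num))⟩
  · have h := (Entry.mem_ofEnds_iff _ _ _ _ _).1 (hp .Upp la214CLDAEmery_Upp rfl)
    exact (Entry.mem_ofEnds_iff _ _ _ _ _).2 ⟨le_trans (by exact_mod_cast (by norm_num)) h.1, le_trans h.2 (by exact_mod_cast (by norm_num))⟩
  · exact hp .Vpd _ rfl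
  · exact hp .nHoles _ rfl

/-- **Sound Δ-entry replacement on the slice**: the fl-image of every member of the source sub-box, at any TB-occ reference occupation in the
range, lies in `emeryBoxLa214CLDA`. [folklore] -/
theorem flImage_mem_emeryBoxLa214CLDA {nd np : ℝ}
    (hnd : (((162/125 : ℚ)) : ℝ) ≤ nd ∧ nd ≤ (((751/500 : ℚ)) : ℝ)) (hnp : (((1749/1000 : ℚ)) : ℝ) ≤ np ∧ np ≤ (((463/250 : ℚ)) : ℝ))
    {p : EmeryCoord → ℝ} (hp : emeryBoxLa214CLDASrc.Mem p) : emeryBoxLa214CLDA.Mem (flImage nd np p) :=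
  flImage_mem_update (E := emeryBoxLa214CLDASrc) (eD := la214DFTEmery_Delta) (eUd := la214CLDAEmery_Udd) (eUp := la214CLDAEmery_Upp) (eFl := la214CLDAEmery_Delta) rfl rfl rfl
    (by rw [la214CLDAEmery_Udd, Entry.encl_ofEnds_fst]; norm_num) (by rw [la214CLDAEmery_Upp, Entry.encl_ofEnds_fst]; norm_num) (by norm_num) (by norm_num)
    (by rw [la214CLDAEmery_Delta, la214DFTEmery_Delta, la214CLDAEmery_Udd, la214CLDAEmery_Upp, Entry.encl_ofEnds_fst, Entry.encl_ofEnds_fst, Entry.encl_ofEnds_snd, Entry.encl_ofEnds_fst]; norm_num)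
    (by rw [la214CLDAEmery_Delta, la214DFTEmery_Delta, la214CLDAEmery_Udd, la214CLDAEmery_Upp, Entry.encl_ofEnds_snd, Entry.encl_ofEnds_snd, Entry.encl_ofEnds_fst, Entry.encl_ofEnds_snd]; norm_num)
    hnd hnp hp

/-- Words on the slice are words under reading fl on its source sub-box. [folklore] -/
theorem holdsOn_emeryBoxLa214CLDASrc_fl {nd np : ℝ}
    (hnd : (((162/125 : ℚ)) : ℝ) ≤ nd ∧ nd ≤ (((751/500 : ℚ)) : ℝ)) (hnp : (((1749/1000 : ℚ)) : ℝ) ≤ np ∧ np ≤ (((463/250 : ℚ)) : ℝ))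
    {W : (EmeryCoord → ℝ) → Prop} (hW : HoldsOn W emeryBoxLa214CLDA) : HoldsOn (fun p => W (flImage nd np p)) emeryBoxLa214CLDASrc :=
  fun _ hp => hW _ (flImage_mem_emeryBoxLa214CLDA hnd hnp hp)

/-- The slice reads back its entries (for the seam doors). [folklore] -/
theorem emeryBoxLa214CLDA_entries :
    emeryBoxLa214CLDA .tpd = some la214Emery_tpd ∧ emeryBoxLa214CLDA .tpp = some la214Emery_tpp ∧ emeryBoxLa214CLDA .DeltaPd = some la214CLDAEmery_Delta ∧ emeryBoxLa214CLDA .Udd = some la214CLDAEmery_Udd ∧ emeryBoxLa214CLDA .Upp = some la214CLDAEmery_Upp := by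
  refine ⟨?_, ?_, ?_, ?_, ?_⟩ <;> simp [emeryBoxLa214CLDA, emeryBoxLa214CLDASrc, Function.update]

/-- Six-box corners of the slice at `εp = 0`: `![129/100, 23/50, -269/100, 0, 21/2, 4]` / `![38/25, 33/50, -9/50, 0, 21/2, 4]`. [folklore] -/
theorem la214CLDA_emeryLoHi :
    emeryLo 0 la214Emery_tpd la214Emery_tpp la214CLDAEmery_Delta la214CLDAEmery_Udd la214CLDAEmery_Upp = ![129/100, 23/50, -269/100, 0, 21/2, 4] ∧ emeryHi 0 la214Emery_tpd la214Emery_tpp la214CLDAEmery_Delta la214CLDAEmery_Udd la214CLDAEmery_Upp = ![38/25, 33/50, -9/50, 0, 21/2, 4] := by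
  constructor <;> (ext i; fin_cases i <;> simp [emeryLo, emeryHi, la214Emery_tpd, la214Emery_tpp, la214CLDAEmery_Delta, la214CLDAEmery_Udd, la214CLDAEmery_Upp])

/-- **Vertex-certified three-band energy floor on the slice** (64 vertices; `U` coordinates degenerate ⇒ 16 distinct points).
[cite: Israel1979, Thm. I.3.4] -/
theorem emeryBoxLa214CLDA_energyFloor (s : Fin 4 → ℝ) (ρ : ℝ) {m : ℝ}
    (hm : ∀ w ∈ Fintype.piFinset (fun i => ({(![129/100, 23/50, -269/100, 0, 21/2, 4] : Fin 6 → ℝ) i, (![38/25, 33/50, -9/50, 0, 21/2, 4] : Fin 6 → ℝ) i} : Finset ℝ)),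
      m ≤ emeryEnergyDensity (emeryLine s w) ρ) :
    HoldsOn (fun p : EmeryCoord → ℝ => m ≤ emeryEnergyDensity (emeryLine s (emeryLineCoords 0 p)) ρ) emeryBoxLa214CLDA := by
  have h := holdsOn_emeryEnergyFloor (E := emeryBoxLa214CLDA) (εp := 0) (eA := la214Emery_tpd) (eB := la214Emery_tpp) (eD := la214CLDAEmery_Delta) (eUd := la214CLDAEmery_Udd) (eUp := la214CLDAEmery_Upp)
    emeryBoxLa214CLDA_entries.1 emeryBoxLa214CLDA_entries.2.1 emeryBoxLa214CLDA_entries.2.2.1 emeryBoxLa214CLDA_entries.2.2.2.1 emeryBoxLa214CLDA_entries.2.2.2.2 s ρ (m := m)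
    (by rw [la214CLDA_emeryLoHi.1, la214CLDA_emeryLoHi.2]; exact hm)
  simpa using h

/-- **Four corner certificates bind the slice**: `(t_pd, t_pp)` corners at `ε_d = -269/100`, `ε_p = 0`, `U_d = 21/2`, `U_p = 4`
(lower-face rule). [cite: Israel1979, Thm. I.3.4] -/
theorem emeryBoxLa214CLDA_energyFloor_lowerFace (s : Fin 4 → ℝ) (ρ : ℝ) {m : ℝ}
    (hm : ∀ w ∈ Fintype.piFinset (fun i => ({(![129/100, 23/50, -269/100, 0, 21/2, 4] : Fin 6 → ℝ) i, (![38/25, 33/50, -269/100, 0, 21/2, 4] : Fin 6 → ℝ) i} : Finset ℝ)),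
      m ≤ emeryEnergyDensity (emeryLine s w) ρ) :
    HoldsOn (fun p : EmeryCoord → ℝ => m ≤ emeryEnergyDensity (emeryLine s (emeryLineCoords 0 p)) ρ) emeryBoxLa214CLDA := by
  have hlf : lowerFace (![129/100, 23/50, -269/100, 0, 21/2, 4] : Fin 6 → ℝ) ![38/25, 33/50, -9/50, 0, 21/2, 4] = ![38/25, 33/50, -269/100, 0, 21/2, 4] := by ext i; fin_cases i <;> simp [lowerFace]
  have h := holdsOn_emeryEnergyFloor_lowerFace (E := emeryBoxLa214CLDA) (εp := 0) (eA := la214Emery_tpd) (eB := la214Emery_tpp) (eD := la214CLDAEmery_Delta) (eUd := la214CLDAEmery_Udd)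
    (eUp := la214CLDAEmery_Upp) emeryBoxLa214CLDA_entries.1 emeryBoxLa214CLDA_entries.2.1 emeryBoxLa214CLDA_entries.2.2.1 emeryBoxLa214CLDA_entries.2.2.2.1 emeryBoxLa214CLDA_entries.2.2.2.2 s ρ (m := m)
    (by rw [la214CLDA_emeryLoHi.1, la214CLDA_emeryLoHi.2, hlf]; exact hm)
  simpa using h

/-- **Width budget of the slice**: `8·w(t_pd) + 8·w(t_pp) + 2·w(Δ^e) + 0 + 0 = 423/50 = 8.46` per site. [folklore] -/
theorem la214CLDA_widthBudget :
    8 * la214Emery_tpd.widthR + 8 * la214Emery_tpp.widthR + 2 * la214CLDAEmery_Delta.widthR + la214CLDAEmery_Udd.widthR + 2 * la214CLDAEmery_Upp.widthR = ((423/50 : ℚ) : ℝ) := by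
  simp only [Entry.widthR, la214Emery_tpd, la214Emery_tpp, la214CLDAEmery_Delta, la214CLDAEmery_Udd, la214CLDAEmery_Upp, Entry.encl_ofEnds_fst, Entry.encl_ofEnds_snd]
  push_cast; norm_num

/-! ### Slice «static cRPA@LDA dp-MLWF pair Werner2015 p.5 (U_dd(0) 7.00, U_pp 4.64; U_pd 1.88)»: `(U_dd, U_pp) = (7, 116/25)` -/

/-- `Udd` pinned at the named member's value `7` («static cRPA@LDA dp-MLWF pair Werner2015 p.5 (U_dd(0) 7.00, U_pp 4.64; U_pd 1.88)»). [folklore] -/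
def la214CRPAEmery_Udd : Entry := Entry.ofEnds (7) (7) le_rfl .screening
/-- `Upp` pinned at `116/25` («static cRPA@LDA dp-MLWF pair Werner2015 p.5 (U_dd(0) 7.00, U_pp 4.64; U_pd 1.88)»). [folklore] -/
def la214CRPAEmery_Upp : Entry := Entry.ofEnds (116/25) (116/25) le_rfl .screening
/-- **The bare-electron (V@MF) `Delta_pd` entry of the slice «static cRPA@LDA dp-MLWF pair Werner2015 p.5 (U_dd(0) 7.00, U_pp 4.64; U_pd 1.88)»**: `[1/2, 269/100]` = outward 2-dp rounding of
`[17/10 − 7·751/500/2 + 116/25·1749/1000/2, 73/25 − 7·162/125/2 + 116/25·463/250/2] = [0.5007, 2.6806]` (Δ source range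
[17/10, 73/25], TB-occ reference range n̄_d ∈ [162/125, 751/500], n̄_p ∈ [1749/1000, 463/250]). By-member TB-occ images at this pair: see the table in the module docstring. [folklore] -/
def la214CRPAEmery_Delta : Entry := Entry.ofEnds (1/2) (269/100) (by norm_num) .screening

/-- The SOURCE sub-box of the slice: the companion with `Delta_pd` narrowed to `la214DFTEmery_Delta` and `(U_dd, U_pp)` pinned at the named member
(a sub-box of `emeryBoxLa214DFT`: `emeryBoxLa214CRPASrc_refines`). [folklore] -/
def emeryBoxLa214CRPASrc : EmeryBox := fun c =>
  match c with
  | .DeltaPd => some la214DFTEmery_Delta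
  | .tpd => some la214Emery_tpd
  | .tpp => some la214Emery_tpp
  | .tppP => some la214Emery_tppP
  | .Udd => some la214CRPAEmery_Udd
  | .Upp => some la214CRPAEmery_Upp
  | .Vpd => some la214Emery_Vpd
  | .nHoles => some la214Emery_nH

/-- **The U-SLICE «static cRPA@LDA dp-MLWF pair Werner2015 p.5 (U_dd(0) 7.00, U_pp 4.64; U_pd 1.88)»** (row of record per R-B16(b)): the source sub-box with `Delta_pd` replaced by its bare-e image `la214CRPAEmery_Delta`. [folklore] -/
def emeryBoxLa214CRPA : EmeryBox := Function.update emeryBoxLa214CRPASrc .DeltaPd (some la214CRPAEmery_Delta)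

/-- The source sub-box refines the companion `emeryBoxLa214DFT` (pinned U values and the Δ sub-range lie inside the companion rows). [folklore] -/
theorem emeryBoxLa214CRPASrc_refines : emeryBoxLa214CRPASrc.Refines emeryBoxLa214DFT := by
  intro p hp i e hi
  cases i <;> simp only [emeryBoxLa214DFT, Option.some.injEq] at hi <;> subst hi
  · have h := (Entry.mem_ofEnds_iff _ _ _ _ _).1 (hp .DeltaPd la214DFTEmery_Delta rfl)
    exact (Entry.mem_ofEnds_iff _ _ _ _ _).2 ⟨le_trans (by exact_mod_cast (by norm_num)) h.1, le_trans h.2 (by exact_mod_cast (by norm_num))⟩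
  · exact hp .tpd _ rfl
  · exact hp .tpp _ rfl
  · exact hp .tppP _ rfl
  · have h := (Entry.mem_ofEnds_iff _ _ _ _ _).1 (hp .Udd la214CRPAEmery_Udd rfl)
    exact (Entry.mem_ofEnds_iff _ _ _ _ _).2 ⟨le_trans (by exact_mod_cast (by norm_num)) h.1, le_trans h.2 (by exact_mod_cast (by norm_num))⟩
  · have h := (Entry.mem_ofEnds_iff _ _ _ _ _).1 (hp .Upp la214CRPAEmery_Upp rfl)
    exact (Entry.mem_ofEnds_iff _ _ _ _ _).2 ⟨le_trans (by exact_mod_cast (by norm_num)) h.1, le_trans h.2 (by exact_mod_cast (by norm_num))⟩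
  · exact hp .Vpd _ rfl
  · exact hp .nHoles _ rfl

/-- **Sound Δ-entry replacement on the slice**: the fl-image of every member of the source sub-box, at any TB-occ reference occupation in the
range, lies in `emeryBoxLa214CRPA`. [folklore] -/
theorem flImage_mem_emeryBoxLa214CRPA {nd np : ℝ}
    (hnd : (((162/125 : ℚ)) : ℝ) ≤ nd ∧ nd ≤ (((751/500 : ℚ)) : ℝ)) (hnp : (((1749/1000 : ℚ)) : ℝ) ≤ np ∧ np ≤ (((463/250 : ℚ)) : ℝ))
    {p : EmeryCoord → ℝ} (hp : emeryBoxLa214CRPASrc.Mem p) : emeryBoxLa214CRPA.Mem (flImage nd np p) :=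
  flImage_mem_update (E := emeryBoxLa214CRPASrc) (eD := la214DFTEmery_Delta) (eUd := la214CRPAEmery_Udd) (eUp := la214CRPAEmery_Upp) (eFl := la214CRPAEmery_Delta) rfl rfl rfl
    (by rw [la214CRPAEmery_Udd, Entry.encl_ofEnds_fst]; norm_num) (by rw [la214CRPAEmery_Upp, Entry.encl_ofEnds_fst]; norm_num) (by norm_num) (by norm_num)
    (by rw [la214CRPAEmery_Delta, la214DFTEmery_Delta, la214CRPAEmery_Udd, la214CRPAEmery_Upp, Entry.encl_ofEnds_fst, Entry.encl_ofEnds_fst, Entry.encl_ofEnds_snd, Entry.encl_ofEnds_fst]; norm_num)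
    (by rw [la214CRPAEmery_Delta, la214DFTEmery_Delta, la214CRPAEmery_Udd, la214CRPAEmery_Upp, Entry.encl_ofEnds_snd, Entry.encl_ofEnds_snd, Entry.encl_ofEnds_fst, Entry.encl_ofEnds_snd]; norm_num)
    hnd hnp hp

/-- Words on the slice are words under reading fl on its source sub-box. [folklore] -/
theorem holdsOn_emeryBoxLa214CRPASrc_fl {nd np : ℝ}
    (hnd : (((162/125 : ℚ)) : ℝ) ≤ nd ∧ nd ≤ (((751/500 : ℚ)) : ℝ)) (hnp : (((1749/1000 : ℚ)) : ℝ) ≤ np ∧ np ≤ (((463/250 : ℚ)) : ℝ))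
    {W : (EmeryCoord → ℝ) → Prop} (hW : HoldsOn W emeryBoxLa214CRPA) : HoldsOn (fun p => W (flImage nd np p)) emeryBoxLa214CRPASrc :=
  fun _ hp => hW _ (flImage_mem_emeryBoxLa214CRPA hnd hnp hp)

/-- The slice reads back its entries (for the seam doors). [folklore] -/
theorem emeryBoxLa214CRPA_entries :
    emeryBoxLa214CRPA .tpd = some la214Emery_tpd ∧ emeryBoxLa214CRPA .tpp = some la214Emery_tpp ∧ emeryBoxLa214CRPA .DeltaPd = some la214CRPAEmery_Delta ∧ emeryBoxLa214CRPA .Udd = some la214CRPAEmery_Udd ∧ emeryBoxLa214CRPA .Upp = some la214CRPAEmery_Upp := by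
  refine ⟨?_, ?_, ?_, ?_, ?_⟩ <;> simp [emeryBoxLa214CRPA, emeryBoxLa214CRPASrc, Function.update]

/-- Six-box corners of the slice at `εp = 0`: `![129/100, 23/50, 1/2, 0, 7, 116/25]` / `![38/25, 33/50, 269/100, 0, 7, 116/25]`. [folklore] -/
theorem la214CRPA_emeryLoHi :
    emeryLo 0 la214Emery_tpd la214Emery_tpp la214CRPAEmery_Delta la214CRPAEmery_Udd la214CRPAEmery_Upp = ![129/100, 23/50, 1/2, 0, 7, 116/25] ∧ emeryHi 0 la214Emery_tpd la214Emery_tpp la214CRPAEmery_Delta la214CRPAEmery_Udd la214CRPAEmery_Upp = ![38/25, 33/50, 269/100, 0, 7, 116/25] := by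
  constructor <;> (ext i; fin_cases i <;> simp [emeryLo, emeryHi, la214Emery_tpd, la214Emery_tpp, la214CRPAEmery_Delta, la214CRPAEmery_Udd, la214CRPAEmery_Upp])

/-- **Vertex-certified three-band energy floor on the slice** (64 vertices; `U` coordinates degenerate ⇒ 16 distinct points).
[cite: Israel1979, Thm. I.3.4] -/
theorem emeryBoxLa214CRPA_energyFloor (s : Fin 4 → ℝ) (ρ : ℝ) {m : ℝ}
    (hm : ∀ w ∈ Fintype.piFinset (fun i => ({(![129/100, 23/50, 1/2, 0, 7, 116/25] : Fin 6 → ℝ) i, (![38/25, 33/50, 269/100, 0, 7, 116/25] : Fin 6 → ℝ) i} : Finset ℝ)),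
      m ≤ emeryEnergyDensity (emeryLine s w) ρ) :
    HoldsOn (fun p : EmeryCoord → ℝ => m ≤ emeryEnergyDensity (emeryLine s (emeryLineCoords 0 p)) ρ) emeryBoxLa214CRPA := by
  have h := holdsOn_emeryEnergyFloor (E := emeryBoxLa214CRPA) (εp := 0) (eA := la214Emery_tpd) (eB := la214Emery_tpp) (eD := la214CRPAEmery_Delta) (eUd := la214CRPAEmery_Udd) (eUp := la214CRPAEmery_Upp)
    emeryBoxLa214CRPA_entries.1 emeryBoxLa214CRPA_entries.2.1 emeryBoxLa214CRPA_entries.2.2.1 emeryBoxLa214CRPA_entries.2.2.2.1 emeryBoxLa214CRPA_entries.2.2.2.2 s ρ (m := m)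
    (by rw [la214CRPA_emeryLoHi.1, la214CRPA_emeryLoHi.2]; exact hm)
  simpa using h

/-- **Four corner certificates bind the slice**: `(t_pd, t_pp)` corners at `ε_d = 1/2`, `ε_p = 0`, `U_d = 7`, `U_p = 116/25`
(lower-face rule). [cite: Israel1979, Thm. I.3.4] -/
theorem emeryBoxLa214CRPA_energyFloor_lowerFace (s : Fin 4 → ℝ) (ρ : ℝ) {m : ℝ}
    (hm : ∀ w ∈ Fintype.piFinset (fun i => ({(![129/100, 23/50, 1/2, 0, 7, 116/25] : Fin 6 → ℝ) i, (![38/25, 33/50, 1/2, 0, 7, 116/25] : Fin 6 → ℝ) i} : Finset ℝ)),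
      m ≤ emeryEnergyDensity (emeryLine s w) ρ) :
    HoldsOn (fun p : EmeryCoord → ℝ => m ≤ emeryEnergyDensity (emeryLine s (emeryLineCoords 0 p)) ρ) emeryBoxLa214CRPA := by
  have hlf : lowerFace (![129/100, 23/50, 1/2, 0, 7, 116/25] : Fin 6 → ℝ) ![38/25, 33/50, 269/100, 0, 7, 116/25] = ![38/25, 33/50, 1/2, 0, 7, 116/25] := by ext i; fin_cases i <;> simp [lowerFace]
  have h := holdsOn_emeryEnergyFloor_lowerFace (E := emeryBoxLa214CRPA) (εp := 0) (eA := la214Emery_tpd) (eB := la214Emery_tpp) (eD := la214CRPAEmery_Delta) (eUd := la214CRPAEmery_Udd)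
    (eUp := la214CRPAEmery_Upp) emeryBoxLa214CRPA_entries.1 emeryBoxLa214CRPA_entries.2.1 emeryBoxLa214CRPA_entries.2.2.1 emeryBoxLa214CRPA_entries.2.2.2.1 emeryBoxLa214CRPA_entries.2.2.2.2 s ρ (m := m)
    (by rw [la214CRPA_emeryLoHi.1, la214CRPA_emeryLoHi.2, hlf]; exact hm)
  simpa using h

/-- **Width budget of the slice**: `8·w(t_pd) + 8·w(t_pp) + 2·w(Δ^e) + 0 + 0 = 391/50 = 7.82` per site. [folklore] -/
theorem la214CRPA_widthBudget :
    8 * la214Emery_tpd.widthR + 8 * la214Emery_tpp.widthR + 2 * la214CRPAEmery_Delta.widthR + la214CRPAEmery_Udd.widthR + 2 * la214CRPAEmery_Upp.widthR = ((391/50 : ℚ) : ℝ) := by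
  simp only [Entry.widthR, la214Emery_tpd, la214Emery_tpp, la214CRPAEmery_Delta, la214CRPAEmery_Udd, la214CRPAEmery_Upp, Entry.encl_ofEnds_fst, Entry.encl_ofEnds_snd]
  push_cast; norm_num

/-! ### Slice «canonical solver pair Kung2016 p.3 (U_dd 8.5, U_pp 4.1)»: `(U_dd, U_pp) = (17/2, 41/10)` -/

/-- `Udd` pinned at the named member's value `17/2` («canonical solver pair Kung2016 p.3 (U_dd 8.5, U_pp 4.1)»). [folklore] -/
def la214KungEmery_Udd : Entry := Entry.ofEnds (17/2) (17/2) le_rfl .screening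
/-- `Upp` pinned at `41/10` («canonical solver pair Kung2016 p.3 (U_dd 8.5, U_pp 4.1)»). [folklore] -/
def la214KungEmery_Upp : Entry := Entry.ofEnds (41/10) (41/10) le_rfl .screening
/-- **The bare-electron (V@MF) `Delta_pd` entry of the slice «canonical solver pair Kung2016 p.3 (U_dd 8.5, U_pp 4.1)»**: `[-11/10, 121/100]` = outward 2-dp rounding of
`[17/10 − 17/2·751/500/2 + 41/10·1749/1000/2, 73/25 − 17/2·162/125/2 + 41/10·463/250/2] = [-1.0980, 1.2086]` (Δ source range
[17/10, 73/25], TB-occ reference range n̄_d ∈ [162/125, 751/500], n̄_p ∈ [1749/1000, 463/250]). By-member TB-occ images at this pair: see the table in the module docstring. [folklore] -/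
def la214KungEmery_Delta : Entry := Entry.ofEnds (-11/10) (121/100) (by norm_num) .screening

/-- The SOURCE sub-box of the slice: the companion with `Delta_pd` narrowed to `la214DFTEmery_Delta` and `(U_dd, U_pp)` pinned at the named member
(a sub-box of `emeryBoxLa214DFT`: `emeryBoxLa214KungSrc_refines`). [folklore] -/
def emeryBoxLa214KungSrc : EmeryBox := fun c =>
  match c with
  | .DeltaPd => some la214DFTEmery_Delta
  | .tpd => some la214Emery_tpd
  | .tpp => some la214Emery_tpp
  | .tppP => some la214Emery_tppP
  | .Udd => some la214KungEmery_Udd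
  | .Upp => some la214KungEmery_Upp
  | .Vpd => some la214Emery_Vpd
  | .nHoles => some la214Emery_nH

/-- **The U-SLICE «canonical solver pair Kung2016 p.3 (U_dd 8.5, U_pp 4.1)»** (row of record per R-B16(b)): the source sub-box with `Delta_pd` replaced by its bare-e image `la214KungEmery_Delta`. [folklore] -/
def emeryBoxLa214Kung : EmeryBox := Function.update emeryBoxLa214KungSrc .DeltaPd (some la214KungEmery_Delta)

/-- The source sub-box refines the companion `emeryBoxLa214DFT` (pinned U values and the Δ sub-range lie inside the companion rows). [folklore] -/
theorem emeryBoxLa214KungSrc_refines : emeryBoxLa214KungSrc.Refines emeryBoxLa214DFT := by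
  intro p hp i e hi
  cases i <;> simp only [emeryBoxLa214DFT, Option.some.injEq] at hi <;> subst hi
  · have h := (Entry.mem_ofEnds_iff _ _ _ _ _).1 (hp .DeltaPd la214DFTEmery_Delta rfl)
    exact (Entry.mem_ofEnds_iff _ _ _ _ _).2 ⟨le_trans (by exact_mod_cast (by norm_num)) h.1, le_trans h.2 (by exact_mod_cast (by norm_num))⟩
  · exact hp .tpd _ rfl
  · exact hp .tpp _ rfl
  · exact hp .tppP _ rfl
  · have h := (Entry.mem_ofEnds_iff _ _ _ _ _).1 (hp .Udd la214KungEmery_Udd rfl)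
    exact (Entry.mem_ofEnds_iff _ _ _ _ _).2 ⟨le_trans (by exact_mod_cast (by norm_num)) h.1, le_trans h.2 (by exact_mod_cast (by norm_num))⟩
  · have h := (Entry.mem_ofEnds_iff _ _ _ _ _).1 (hp .Upp la214KungEmery_Upp rfl)
    exact (Entry.mem_ofEnds_iff _ _ _ _ _).2 ⟨le_trans (by exact_mod_cast (by norm_num)) h.1, le_trans h.2 (by exact_mod_cast (by norm_num))⟩
  · exact hp .Vpd _ rfl
  · exact hp .nHoles _ rfl

/-- **Sound Δ-entry replacement on the slice**: the fl-image of every member of the source sub-box, at any TB-occ reference occupation in the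
range, lies in `emeryBoxLa214Kung`. [folklore] -/
theorem flImage_mem_emeryBoxLa214Kung {nd np : ℝ}
    (hnd : (((162/125 : ℚ)) : ℝ) ≤ nd ∧ nd ≤ (((751/500 : ℚ)) : ℝ)) (hnp : (((1749/1000 : ℚ)) : ℝ) ≤ np ∧ np ≤ (((463/250 : ℚ)) : ℝ))
    {p : EmeryCoord → ℝ} (hp : emeryBoxLa214KungSrc.Mem p) : emeryBoxLa214Kung.Mem (flImage nd np p) :=
  flImage_mem_update (E := emeryBoxLa214KungSrc) (eD := la214DFTEmery_Delta) (eUd := la214KungEmery_Udd) (eUp := la214KungEmery_Upp) (eFl := la214KungEmery_Delta) rfl rfl rfl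
    (by rw [la214KungEmery_Udd, Entry.encl_ofEnds_fst]; norm_num) (by rw [la214KungEmery_Upp, Entry.encl_ofEnds_fst]; norm_num) (by norm_num) (by norm_num)
    (by rw [la214KungEmery_Delta, la214DFTEmery_Delta, la214KungEmery_Udd, la214KungEmery_Upp, Entry.encl_ofEnds_fst, Entry.encl_ofEnds_fst, Entry.encl_ofEnds_snd, Entry.encl_ofEnds_fst]; norm_num)
    (by rw [la214KungEmery_Delta, la214DFTEmery_Delta, la214KungEmery_Udd, la214KungEmery_Upp, Entry.encl_ofEnds_snd, Entry.encl_ofEnds_snd, Entry.encl_ofEnds_fst, Entry.encl_ofEnds_snd]; norm_num)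
    hnd hnp hp

/-- Words on the slice are words under reading fl on its source sub-box. [folklore] -/
theorem holdsOn_emeryBoxLa214KungSrc_fl {nd np : ℝ}
    (hnd : (((162/125 : ℚ)) : ℝ) ≤ nd ∧ nd ≤ (((751/500 : ℚ)) : ℝ)) (hnp : (((1749/1000 : ℚ)) : ℝ) ≤ np ∧ np ≤ (((463/250 : ℚ)) : ℝ))
    {W : (EmeryCoord → ℝ) → Prop} (hW : HoldsOn W emeryBoxLa214Kung) : HoldsOn (fun p => W (flImage nd np p)) emeryBoxLa214KungSrc :=
  fun _ hp => hW _ (flImage_mem_emeryBoxLa214Kung hnd hnp hp)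

/-- The slice reads back its entries (for the seam doors). [folklore] -/
theorem emeryBoxLa214Kung_entries :
    emeryBoxLa214Kung .tpd = some la214Emery_tpd ∧ emeryBoxLa214Kung .tpp = some la214Emery_tpp ∧ emeryBoxLa214Kung .DeltaPd = some la214KungEmery_Delta ∧ emeryBoxLa214Kung .Udd = some la214KungEmery_Udd ∧ emeryBoxLa214Kung .Upp = some la214KungEmery_Upp := by
  refine ⟨?_, ?_, ?_, ?_, ?_⟩ <;> simp [emeryBoxLa214Kung, emeryBoxLa214KungSrc, Function.update]

/-- Six-box corners of the slice at `εp = 0`: `![129/100, 23/50, -11/10, 0, 17/2, 41/10]` / `![38/25, 33/50, 121/100, 0, 17/2, 41/10]`. [folklore] -/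
theorem la214Kung_emeryLoHi :
    emeryLo 0 la214Emery_tpd la214Emery_tpp la214KungEmery_Delta la214KungEmery_Udd la214KungEmery_Upp = ![129/100, 23/50, -11/10, 0, 17/2, 41/10] ∧ emeryHi 0 la214Emery_tpd la214Emery_tpp la214KungEmery_Delta la214KungEmery_Udd la214KungEmery_Upp = ![38/25, 33/50, 121/100, 0, 17/2, 41/10] := by
  constructor <;> (ext i; fin_cases i <;> simp [emeryLo, emeryHi, la214Emery_tpd, la214Emery_tpp, la214KungEmery_Delta, la214KungEmery_Udd, la214KungEmery_Upp])

/-- **Vertex-certified three-band energy floor on the slice** (64 vertices; `U` coordinates degenerate ⇒ 16 distinct points).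
[cite: Israel1979, Thm. I.3.4] -/
theorem emeryBoxLa214Kung_energyFloor (s : Fin 4 → ℝ) (ρ : ℝ) {m : ℝ}
    (hm : ∀ w ∈ Fintype.piFinset (fun i => ({(![129/100, 23/50, -11/10, 0, 17/2, 41/10] : Fin 6 → ℝ) i, (![38/25, 33/50, 121/100, 0, 17/2, 41/10] : Fin 6 → ℝ) i} : Finset ℝ)),
      m ≤ emeryEnergyDensity (emeryLine s w) ρ) :
    HoldsOn (fun p : EmeryCoord → ℝ => m ≤ emeryEnergyDensity (emeryLine s (emeryLineCoords 0 p)) ρ) emeryBoxLa214Kung := by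
  have h := holdsOn_emeryEnergyFloor (E := emeryBoxLa214Kung) (εp := 0) (eA := la214Emery_tpd) (eB := la214Emery_tpp) (eD := la214KungEmery_Delta) (eUd := la214KungEmery_Udd) (eUp := la214KungEmery_Upp)
    emeryBoxLa214Kung_entries.1 emeryBoxLa214Kung_entries.2.1 emeryBoxLa214Kung_entries.2.2.1 emeryBoxLa214Kung_entries.2.2.2.1 emeryBoxLa214Kung_entries.2.2.2.2 s ρ (m := m)
    (by rw [la214Kung_emeryLoHi.1, la214Kung_emeryLoHi.2]; exact hm)
  simpa using h

/-- **Four corner certificates bind the slice**: `(t_pd, t_pp)` corners at `ε_d = -11/10`, `ε_p = 0`, `U_d = 17/2`, `U_p = 41/10`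
(lower-face rule). [cite: Israel1979, Thm. I.3.4] -/
theorem emeryBoxLa214Kung_energyFloor_lowerFace (s : Fin 4 → ℝ) (ρ : ℝ) {m : ℝ}
    (hm : ∀ w ∈ Fintype.piFinset (fun i => ({(![129/100, 23/50, -11/10, 0, 17/2, 41/10] : Fin 6 → ℝ) i, (![38/25, 33/50, -11/10, 0, 17/2, 41/10] : Fin 6 → ℝ) i} : Finset ℝ)),
      m ≤ emeryEnergyDensity (emeryLine s w) ρ) :
    HoldsOn (fun p : EmeryCoord → ℝ => m ≤ emeryEnergyDensity (emeryLine s (emeryLineCoords 0 p)) ρ) emeryBoxLa214Kung := by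
  have hlf : lowerFace (![129/100, 23/50, -11/10, 0, 17/2, 41/10] : Fin 6 → ℝ) ![38/25, 33/50, 121/100, 0, 17/2, 41/10] = ![38/25, 33/50, -11/10, 0, 17/2, 41/10] := by ext i; fin_cases i <;> simp [lowerFace]
  have h := holdsOn_emeryEnergyFloor_lowerFace (E := emeryBoxLa214Kung) (εp := 0) (eA := la214Emery_tpd) (eB := la214Emery_tpp) (eD := la214KungEmery_Delta) (eUd := la214KungEmery_Udd)
    (eUp := la214KungEmery_Upp) emeryBoxLa214Kung_entries.1 emeryBoxLa214Kung_entries.2.1 emeryBoxLa214Kung_entries.2.2.1 emeryBoxLa214Kung_entries.2.2.2.1 emeryBoxLa214Kung_entries.2.2.2.2 s ρ (m := m)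
    (by rw [la214Kung_emeryLoHi.1, la214Kung_emeryLoHi.2, hlf]; exact hm)
  simpa using h

/-- **Width budget of the slice**: `8·w(t_pd) + 8·w(t_pp) + 2·w(Δ^e) + 0 + 0 = 403/50 = 8.06` per site. [folklore] -/
theorem la214Kung_widthBudget :
    8 * la214Emery_tpd.widthR + 8 * la214Emery_tpp.widthR + 2 * la214KungEmery_Delta.widthR + la214KungEmery_Udd.widthR + 2 * la214KungEmery_Upp.widthR = ((403/50 : ℚ) : ℝ) := by
  simp only [Entry.widthR, la214Emery_tpd, la214Emery_tpp, la214KungEmery_Delta, la214KungEmery_Udd, la214KungEmery_Upp, Entry.encl_ofEnds_fst, Entry.encl_ofEnds_snd]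
  push_cast; norm_num

end

end Summit.Ventures.CertifiedManyBodySolver.Downfold
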